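import Literature.IUT.HodgeTheaters.LocalFrobenioidsWitness
import Mathlib.CategoryTheory.SingleObj
import Mathlib.Algebra.Category.MonCat.Basic
import HarnessLib

/-!
# [IUTchI] Remark 3.2.3 (i): `OrbitActsOnFtheta` is NOT a consequence of the interface `BadLocalFrobenioid`
# (the involution counter-model)

Mochizuki, *Inter-universal Teichmüller theory I*, §3, Example 3.2 (ii), (v) and Remark 3.2.3 (i), kurims
May-2020 manuscript pp. 70–74 [claim: Mochizuki2012, status: disputed]. abc-iut cell, WAVE-4 (D-0067)
cone-interior seat abc-iut-w4-d047; DAG nodes `IUTchI:Ex3.2(ii)`, `(v)`, `IUTchI:Rmk3.2.3(i)`; sibling of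
`BadLocalFrobenioidClaimsWitness.lean` (all ten typed Example 3.2 clauses hold on the trivial inhabitant) and
`BadLocalFrobenioidClaimsIndependence(2).lean` (the other nine clauses fail on the doubling / halving
inhabitants).

`BadLocalFrobenioid.lean` (abc-iut-L5-t2) types Remark 3.2.3 (i) ("`α` induces an isomorphism of the monoid
`𝒪^▷_{C^Θ_v}(−)` associated to `Θ̲_v` onto the corresponding monoid associated to `Θ̲^α_v`") as the
MODEL-RELATIVE `Prop` `OrbitActsOnFtheta B := ∀ x ∈ B.thetaOrbit, Nonempty (B.OTheta ≅ B.OThetaOf x)` over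
the free fields `OTheta`, `OThetaOf`, `unitsTY`, `lZ` of the interface. THIS FILE gives an inhabitant
`BadLocalFrobenioid.involution l K_v` on which it FAILS: `F̲_v = F÷_v` is the one-object category of the group
`ℤ/2`, every other carrier the terminal category; `𝒪^×(T^÷_{Ÿ_v})` is generated by the involution `ζ`,
`Θ̲_v = id`, and the monoid attached to a unit `Θ̲′` is the trivial monoid for `Θ̲′ = Θ̲_v` but `ℕ` for
`Θ̲′ = ζ` — and `ζ = ζ·Θ̲_v` lies in the indeterminacy orbit of `Θ̲_v` (`ζ` is `2l`-torsion). Hence the clause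
is a hypothesis on the REAL construction ([EtTh] §5; [FrdII] Ex. 1.1 (ii)), to be proved at merge; it is
not vacuous (`BadLocalFrobenioid.trivial_orbitActsOnFtheta`). Nothing here concerns the objects of the text;
typed ≠ proved; no side is taken on [IUTchIII] Cor. 3.12.
-/

noncomputable section

namespace Literature.IUT.HodgeTheaters

open CategoryTheory Witness

/-! ### The involution counter-model for Remark 3.2.3 (i) -/

namespace InvolutionWitness

/-- The group `ℤ/2`, multiplicatively. [folklore] -/
abbrev G : Type := Multiplicative (ZMod 2)

/-- `F̲_v = F÷_v`: the one-object category of `ℤ/2`. [folklore] -/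
abbrev F : Type := SingleObj G

/-- Its object `T^÷_{Ÿ_v}`. [folklore] -/
abbrev obj : F := SingleObj.star G

/-- `1 · 1 = 0` in `ℤ/2`, multiplicatively. [folklore] -/
private theorem G_one_mul_one : (Multiplicative.ofAdd (1 : ZMod 2) : G) * Multiplicative.ofAdd (1 : ZMod 2) = 1 := by
  decide

/-- `1 ≠ 0` in `ℤ/2`, multiplicatively. [folklore] -/
private theorem G_one_ne : (Multiplicative.ofAdd (1 : ZMod 2) : G) ≠ 1 := by decide

/-- The involution `ζ ∈ Aut(T^÷_{Ÿ_v})`. [folklore] -/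
def zeta : Aut obj where
  hom := (Multiplicative.ofAdd (1 : ZMod 2) : G)
  inv := (Multiplicative.ofAdd (1 : ZMod 2) : G)
  hom_inv_id := by rw [SingleObj.comp_as_mul, SingleObj.id_as_one]; exact G_one_mul_one
  inv_hom_id := by rw [SingleObj.comp_as_mul, SingleObj.id_as_one]; exact G_one_mul_one

/-- `ζ ≠ id`. [folklore] -/
private theorem zeta_ne_refl : zeta ≠ Iso.refl obj := fun h => by
  have h' := congrArg Iso.hom h
  rw [Iso.refl_hom, SingleObj.id_as_one] at h'
  exact G_one_ne h'

/-- `ζ² = 1` in `Aut`. [folklore] -/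
private theorem zeta_mul_zeta : zeta * zeta = 1 := by
  apply Aut.ext
  rw [Aut.Aut_mul_def, Iso.trans_hom, SingleObj.comp_as_mul]
  exact G_one_mul_one

open Classical in
/-- The monoid attached to a unit `Θ̲′` (Rmk. 3.2.3 (i) `𝒪^▷` for `Θ̲^α_v`): trivial for `Θ̲′ = id`, the
free monoid `ℕ` otherwise. [folklore] -/
def monoidOf (x : Aut obj) : Ptᵒᵖ ⥤ CommMonCat.{0} := if x = Iso.refl obj then unitMon Pt else natMon Pt

/-- `monoidOf id` is the trivial monoid functor. [folklore] -/
private theorem monoidOf_refl : monoidOf (Iso.refl obj) = unitMon Pt := if_pos rfl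

/-- `monoidOf ζ` is the monoid functor `ℕ`. [folklore] -/
private theorem monoidOf_zeta : monoidOf zeta = natMon Pt := if_neg zeta_ne_refl

/-- The trivial monoid functor and the `ℕ` monoid functor on `Pt` are not isomorphic. [folklore] -/
private theorem not_nonempty_iso_unitMon_natMon : ¬ Nonempty (unitMon Pt ≅ natMon Pt) := by
  rintro ⟨I⟩
  let e : PUnit.{1} ≃* Multiplicative ℕ := (I.app (Opposite.op pt)).commMonCatIsoToMulEquiv
  have h : (Multiplicative.ofAdd (0 : ℕ)) = Multiplicative.ofAdd (1 : ℕ) :=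
    e.symm.injective (Subsingleton.elim _ _)
  exact absurd h (by decide)

/-- A constant functor out of the terminal category is faithful. [folklore] -/
private theorem faithful_of_pt {C : Type} [Category.{0} C] (Φ : Pt ⥤ C) : Φ.Faithful :=
  ⟨fun {_ _} _ _ _ => Subsingleton.elim _ _⟩

end InvolutionWitness

open InvolutionWitness

namespace BadLocalFrobenioid

variable (l : ℕ) (Kv : Type) [Field Kv] [ValuativeRel Kv]

/-- **The involution inhabitant of `BadLocalFrobenioid l K_v`**: `F̲_v = F÷_v` the one-object category
of `ℤ/2`, every other carrier the terminal category; `𝒪^×(T^÷_{Ÿ_v})` := all of `Aut ≅ ℤ/2` ∋ the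
involution `ζ`, `Θ̲_v := id`, `l·ℤ := ⊥`; the monoid attached to `Θ̲′` (`OThetaOf`) is trivial for
`Θ̲′ = Θ̲_v` and `ℕ` otherwise; `q_v = q̲_v = 1`, splittings `⊥`. A toy serving only as a counter-model.
[claim: Mochizuki2012, status: disputed] -/
def involution : BadLocalFrobenioid.{0} l Kv where
  Dv := Pt
  Ddash := Pt
  incl := 𝟭 Pt
  proj := 𝟭 Pt
  adj := Adjunction.id
  Fv := F
  toBase := (Functor.const F).obj pt
  T _ := obj
  T_base _ := eqToIso (Subsingleton.elim _ _)
  Fbirat := F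
  birat := 𝟭 F
  biratBase := (Functor.const F).obj pt
  birat_base := ⟨isoOfPt _ _⟩
  Ydd := pt
  unitsTY := Subgroup.zpowers zeta
  unitsTY_comm x hx y hy := by
    obtain ⟨m, rfl⟩ := Subgroup.mem_zpowers_iff.mp hx
    obtain ⟨n, rfl⟩ := Subgroup.mem_zpowers_iff.mp hy
    exact zpow_mul_comm _ _ _
  theta := Iso.refl _
  theta_mem := Subgroup.one_mem _
  lZ := ⊥
  Cv := Pt
  hull := (Functor.const Pt).obj obj
  hull_faithful := faithful_of_pt _
  q := 1
  qroot := 1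
  qroot_pow := one_pow _
  Cdash := Pt
  CdashBase := 𝟭 Pt
  CdashToC := 𝟭 Pt
  CdashToC_base := ⟨isoOfPt _ _⟩
  tauDashOf _ := botSplitting Pt
  DTheta := Pt
  DThetaIncl := Witness.toOver
  prodEquiv := CategoryTheory.Equivalence.refl
  OTheta := unitMon Pt
  OThetaUnits _ := ⊤
  OThetaUnits_isUnit _ x :=
    ⟨fun _ => @isUnit_of_subsingleton _ _ (inferInstanceAs (Subsingleton PUnit.{1})) x,
      fun _ => Submonoid.mem_top _⟩
  OThetaOf := monoidOf
  OThetaOf_theta := monoidOf_refl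
  CTheta := Pt
  CThetaBase := 𝟭 Pt
  CThetaToBirat := (Functor.const Pt).obj obj
  CThetaToBirat_faithful := faithful_of_pt _
  CThetaToBirat_base := ⟨isoOfPt _ _⟩
  tauThetaOf _ := botSplitting Pt
  dashThetaEquiv := CategoryTheory.Equivalence.refl
  dashThetaEquiv_tau _ := Submonoid.map_bot _
  dashThetaEquiv_base := ⟨isoOfPt _ _⟩

/-- Rmk. 3.2.3 (i) as typed, `OrbitActsOnFtheta` ("`α` induces an isomorphism of the monoid
`𝒪^▷_{C^Θ_v}(−)` onto the monoid associated to `Θ̲^α_v`"), FAILS on the involution inhabitant: the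
`2l`-torsion unit `ζ` carries `Θ̲_v` to the orbit member `ζ·Θ̲_v = ζ`, whose monoid `ℕ` is not isomorphic
to the trivial monoid of `Θ̲_v`. [claim: Mochizuki2012, status: disputed] -/
theorem involution_not_orbitActsOnFtheta : ¬ (involution l Kv).OrbitActsOnFtheta := fun h => by
  have h2 : zeta ^ (2 * l) = (1 : Aut obj) := by
    rw [pow_mul, pow_two, zeta_mul_zeta, one_pow]
  have hζ : zeta ∈ (involution l Kv).mu2l := ⟨Subgroup.mem_zpowers zeta, h2⟩
  have hmem := mu2l_mul_mem_thetaOrbit _ hζ (theta_mem_thetaOrbit (involution l Kv))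
  have hne := h _ hmem
  change Nonempty (unitMon Pt ≅ monoidOf (zeta * 1)) at hne
  rw [mul_one, monoidOf_zeta] at hne
  exact not_nonempty_iso_unitMon_natMon hne

/-- **Independence certificate for Rmk. 3.2.3 (i)**: the interface `BadLocalFrobenioid l K_v` has an
inhabitant on which `OrbitActsOnFtheta` fails; with `BadLocalFrobenioid.trivial_orbitActsOnFtheta` (it holds
on the trivial inhabitant) the clause is independent of the interface. [claim: Mochizuki2012, status: disputed] -/
theorem exists_not_orbitActsOnFtheta : ∃ B : BadLocalFrobenioid.{0} l Kv, ¬ B.OrbitActsOnFtheta :=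
  ⟨involution l Kv, involution_not_orbitActsOnFtheta l Kv⟩

/-- In particular `OrbitActsOnFtheta` is not a theorem about ALL inhabitants of the interface.
[claim: Mochizuki2012, status: disputed] -/
theorem not_forall_orbitActsOnFtheta : ¬ ∀ B : BadLocalFrobenioid.{0} l Kv, B.OrbitActsOnFtheta :=
  fun h => involution_not_orbitActsOnFtheta l Kv (h _)

end BadLocalFrobenioid

end Literature.IUT.HodgeTheaters

end
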